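/-
Copyright (c) 2026 the pub-hodgecm-mathlib formalisation cell (harness21).  Prover seat hodgecm-mathlib-LH7-p04 (g11), 2026-09-02.
Road M6 «ROW 2 ★ DYADIC TWIN» (LEAD F0P3a-plan (g15) T14-66 ROAD-LIMITED; dealer LH4-plan (g8)), brick (O4-G) «GLUED-LATTICE STRUCTURE LEMMA», FILE 1 of 2.
-/
import Mathlib.RingTheory.Valuation.ValuativeRel.Basic
import Mathlib.Topology.Algebra.Valued.ValuativeRel
import Mathlib.Algebra.Module.Submodule.Pointwise
import Mathlib.RingTheory.LocalRing.Basic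
import Mathlib.LinearAlgebra.Span.Basic
import Mathlib.LinearAlgebra.Prod
import HarnessLib

/-!
# Glued lattices in `U × W = E × K` are cyclic over their multiplier ring (the structure lemma behind (O4-G))

Topic `NumberTheory/Automorphic`; namespace `Literature.NumberTheory.Automorphic`.  THEOREMS ONLY (no definition, no instance, no notation, no named fact, no `sorry`).
Cell `pub/hodgecm-mathlib` (D-0151), crux H413 = `stmt-HodgeConjecture-24833`; road M6 «ROW 2 ★ DYADIC TWIN» (ENGINE-CENSUS «(O4) M6» v1.3, MECH-M6-F3F4 FINDING #17∕#18),
brick **(O4-G)** = the lemma FINDING #18 left open: «a self-dual `𝒪_w[δ]`-stable lattice is invertible (indeed cyclic) over its own multiplier ring».  Currency of ★ [T2-a]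
`CyclicSelfDualLatticeTorsor` ∕ ★ `TypeTwoCommutantBridge`: a field `E` with `ValuativeRel E` (`𝒪 = 𝒪[E]`, a valuation ring, local), and the COORDINATE RING `E × K` of a
type-(2) commutant (`K` any field with `[Algebra E K]`; `U = E × 0` the rational line, `W = 0 × K` the `K`-line); lattices are `Submodule 𝒪[E] _`, multipliers act by the
pointwise `•` of `open scoped Pointwise`.  NO hermitian matrix, NO valuation on `K`, NO `2`, NO different: the form enters §3 only through an abstract ORTHOGONAL pairing.
HONEST LABEL: HC_CM is proved only modulo the 2 remaining named inputs (hLiu418 24832, h413 24833) until rung 0 closes; elementary module theory, asserts nothing printed;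
count-neutral base-layer brick ((O4) is not an organ).

THE MATHEMATICS.  For an `𝒪`-submodule `Λ ≤ E × K` write `prU Λ = fst(Λ)`, `L = snd(Λ)`, `ΛU = {y | (y,0) ∈ Λ}`, `J = {x | (0,x) ∈ Λ}` and `O(Λ) = {b ∈ E × K | b • Λ ≤ Λ}`,
`O(L) = {a ∈ K | a • L ≤ L}`.  (§1) A finitely generated `𝒪`-submodule of `E` is CYCLIC (a generator of maximal valuation).  (§2) THE STRUCTURE LEMMA: if `prU Λ = 𝒪u₀`,
`L = O(L)·t` is principal over its multiplier order and `J` is `O(L)`-stable, then there is `u₁` with `prU Λ = 𝒪u₁`, `(u₁, t) ∈ Λ` (the local ring `𝒪` decides: either the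
`U`-coordinate of a lift of `t` is a unit multiple of `u₀`, or the glue module vanishes), the multiplier ring is the GLUED ORDER `(y,a) • Λ ≤ Λ ⟺ y ∈ 𝒪 ∧ a ∈ O(L) ∧
(a − y)·t ∈ J`, and **`Λ = O(Λ)·(u₁, t)`** — cyclic, hence invertible, over its own multiplier ring; no Nakayama, no Goursat, no Gorenstein theory.  (§3) SELF-DUALITY
SUPPLIES THE HYPOTHESIS: for a pairing `P` on `E × K` that is ORTHOGONAL (`P m (0,x′) = T m.2 x′`) with an adjoint map `†` (`T x (a x′) = T (a† x) x′`) and a `†`-stable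
`O(L)`, `Λ = Λ^#` gives `J = L^#` and `O(L) • J ≤ J`.  The quadratic input «`L ⊂ K = E[ξ]` of rank two is principal over its (monogenic) multiplier order» and the
assembled head live in FILE 2 `QuadraticLatticePrincipal`.

* §1 `mem_span_singleton_of_valuation_le`, `exists_eq_span_singleton_of_fg_valuationInteger`.
* §2 `pointwise_smul_le_iff_forall`, `algebraMap_valuationInteger_eq`, `algebraMap_valuationInteger_self` (bookkeeping), `exists_fst_generator_mem`, `smul_le_of_glued`, `smul_le_iff_of_glued`,
  **`exists_generator_of_glued`**.
* §3 `mem_comap_inr_iff_of_selfDual`, **`smul_comap_inr_le_of_selfDual`**.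

## References
* [Jacobowitz1962] R. Jacobowitz, *Hermitian forms over local fields*, Amer. J. Math. 84 (1962): §4 (dual lattices, orthogonal splittings), §7.
* [Serre1980Trees] J.-P. Serre, *Trees* (1980): Ch. II §1.1 (lattices over a discrete valuation ring, classes and stabilisers).
* [Bass1963] H. Bass, *On the ubiquity of Gorenstein rings*, Math. Z. 82 (1963): §7 (invertible = principal fractional ideals of orders; context for (O4-G), not used).
-/

set_option autoImplicit false

open scoped ValuativeRel Pointwise

namespace Literature.NumberTheory.Automorphic

variable {E : Type*} [Field E] [ValuativeRel E] {K : Type*} [Field K] [Algebra E K]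

/-! ## §1 Rank one: finitely generated `𝒪`-submodules of `E` are cyclic -/

/-- If `v(a) ≤ v(u)` then `a ∈ 𝒪·u`. [cite: Serre1980Trees, II.1.1] -/
theorem mem_span_singleton_of_valuation_le {a u : E} (h : ValuativeRel.valuation E a ≤ ValuativeRel.valuation E u) :
    a ∈ 𝒪[E] ∙ u := by
  rcases eq_or_ne u 0 with rfl | hu
  · have : a = 0 := by simpa using h
    simp [this]
  · have hc : a / u ∈ 𝒪[E] := by
      rw [Valuation.mem_integer_iff, map_div₀]
      exact div_le_one_of_le₀ h zero_le
    refine Submodule.mem_span_singleton.2 ⟨⟨a / u, hc⟩, ?_⟩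
    change (a / u) • u = a
    rw [smul_eq_mul, div_mul_cancel₀ a hu]

/-- A finitely generated `𝒪[E]`-submodule of `E` is cyclic (generated by an element of maximal valuation; valuation-ring sibling of ★ `Literature.Algebra.Module.Cocyclic.exists_eq_span_singleton_of_fg`, which assumes a PID). [cite: Serre1980Trees, II.1.1] -/
theorem exists_eq_span_singleton_of_fg_valuationInteger (P : Submodule 𝒪[E] E) (hP : P.FG) : ∃ u : E, P = 𝒪[E] ∙ u := by
  classical
  obtain ⟨S, hS⟩ := hP
  induction S using Finset.induction_on generalizing P with
  | empty => exact ⟨0, by simp [← hS]⟩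
  | insert a S haS ih =>
    obtain ⟨u, hu⟩ := ih (Submodule.span 𝒪[E] (S : Set E)) rfl
    rw [Finset.coe_insert, Submodule.span_insert, hu] at hS
    rcases le_total (ValuativeRel.valuation E a) (ValuativeRel.valuation E u) with h | h
    · refine ⟨u, ?_⟩
      rw [← hS]
      exact le_antisymm (sup_le ((Submodule.span_singleton_le_iff_mem _ _).2 (mem_span_singleton_of_valuation_le h)) le_rfl) le_sup_right
    · refine ⟨a, ?_⟩
      rw [← hS]
      exact le_antisymm (sup_le le_rfl ((Submodule.span_singleton_le_iff_mem _ _).2 (mem_span_singleton_of_valuation_le h))) le_sup_left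

/-! ## §2 The structure lemma: a glued lattice is cyclic over its multiplier ring -/

section Glued

variable {M : Type*} [AddCommGroup M] [Module 𝒪[E] M] {α : Type*} [Monoid α] [DistribMulAction α M] [SMulCommClass α 𝒪[E] M]

/-- `a • S ≤ T ↔ ∀ x ∈ S, a • x ∈ T` (pointwise action on submodules). [cite: Serre1980Trees, II.1.1] -/
theorem pointwise_smul_le_iff_forall (a : α) (S T : Submodule 𝒪[E] M) : a • S ≤ T ↔ ∀ x ∈ S, a • x ∈ T := by
  constructor
  · intro h x hx
    exact h (Submodule.smul_mem_pointwise_smul x a S hx)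
  · intro h x hx
    obtain ⟨b, hb, rfl⟩ := (Submodule.mem_smul_pointwise_iff_exists _ _ _).1 hx
    exact h b hb

end Glued

/-- The structure map `𝒪[E] → K` factors through `E` (scalar tower bookkeeping). [cite: Serre1980Trees, II.1.1] -/
theorem algebraMap_valuationInteger_eq (s : 𝒪[E]) : algebraMap 𝒪[E] K s = algebraMap E K (s : E) :=
  IsScalarTower.algebraMap_apply 𝒪[E] E K s

/-- The structure map `𝒪[E] → E` is the inclusion. [cite: Serre1980Trees, II.1.1] -/
theorem algebraMap_valuationInteger_self (s : 𝒪[E]) : algebraMap 𝒪[E] E s = (s : E) := rfl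

/-- **The lift of the `W`-generator.**  If `prU Λ = 𝒪u₀`, `t ∈ pr_W Λ` generates `L = pr_W Λ` over `O(L)` and `J = Λ ∩ W` is `O(L)`-stable, then `(u₁, t) ∈ Λ` for some
`u₁` with `prU Λ = 𝒪u₁`.  (The `U`-coordinate `c·u₀` of a lift of `t`: if `c` is a unit take `u₁ = c u₀`; otherwise `1 − χ₀ c` is a unit of the local ring `𝒪` and the glue
module vanishes, so `(u₀, t) ∈ Λ`.) [cite: Serre1980Trees, II.1.1] [cite: Jacobowitz1962, §4] -/
theorem exists_fst_generator_mem (Λ : Submodule 𝒪[E] (E × K)) (u₀ : E)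
    (hU : Λ.map ((LinearMap.fst E E K).restrictScalars 𝒪[E]) = 𝒪[E] ∙ u₀)
    (t : K) (ht : t ∈ Λ.map ((LinearMap.snd E E K).restrictScalars 𝒪[E]))
    (hLt : ∀ x ∈ Λ.map ((LinearMap.snd E E K).restrictScalars 𝒪[E]),
      ∃ a : K, a • Λ.map ((LinearMap.snd E E K).restrictScalars 𝒪[E]) ≤ Λ.map ((LinearMap.snd E E K).restrictScalars 𝒪[E]) ∧ x = a * t)
    (hJ : ∀ a : K, a • Λ.map ((LinearMap.snd E E K).restrictScalars 𝒪[E]) ≤ Λ.map ((LinearMap.snd E E K).restrictScalars 𝒪[E]) →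
      a • Λ.comap ((LinearMap.inr E E K).restrictScalars 𝒪[E]) ≤ Λ.comap ((LinearMap.inr E E K).restrictScalars 𝒪[E])) :
    ∃ u₁ : E, Λ.map ((LinearMap.fst E E K).restrictScalars 𝒪[E]) = 𝒪[E] ∙ u₁ ∧ ((u₁, t) : E × K) ∈ Λ := by
  classical
  set L := Λ.map ((LinearMap.snd E E K).restrictScalars 𝒪[E]) with hLdef
  set J := Λ.comap ((LinearMap.inr E E K).restrictScalars 𝒪[E]) with hJdef
  -- membership unfoldings
  have memU : ∀ y : E, y ∈ Λ.map ((LinearMap.fst E E K).restrictScalars 𝒪[E]) ↔ ∃ x : K, ((y, x) : E × K) ∈ Λ := by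
    intro y
    simp only [Submodule.mem_map, LinearMap.coe_restrictScalars, LinearMap.fst_apply, Prod.exists, exists_and_right,
      exists_eq_right]
  have memL : ∀ x : K, x ∈ L ↔ ∃ y : E, ((y, x) : E × K) ∈ Λ := by
    intro x
    simp only [hLdef, Submodule.mem_map, LinearMap.coe_restrictScalars, LinearMap.snd_apply, Prod.exists, exists_eq_right]
  have memJ : ∀ x : K, x ∈ J ↔ ((0, x) : E × K) ∈ Λ := by
    intro x
    simp only [hJdef, Submodule.mem_comap, LinearMap.coe_restrictScalars, LinearMap.inr_apply]
  -- a lift `(u', t)` of `t`, a lift `(u₀, x₀)` of the generator `u₀`; `u' = c • u₀`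
  obtain ⟨u', hu't⟩ := (memL t).1 ht
  have hu₀U : u₀ ∈ Λ.map ((LinearMap.fst E E K).restrictScalars 𝒪[E]) := by
    rw [hU]; exact Submodule.mem_span_singleton_self u₀
  obtain ⟨x₀, hu₀x₀⟩ := (memU u₀).1 hu₀U
  have hu'U : u' ∈ Λ.map ((LinearMap.fst E E K).restrictScalars 𝒪[E]) := (memU u').2 ⟨t, hu't⟩
  rw [hU] at hu'U
  obtain ⟨c, hc⟩ := Submodule.mem_span_singleton.1 hu'U
  by_cases hcu : IsUnit c
  · -- `c` a unit: `u' = c • u₀` generates `prU Λ`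
    refine ⟨u', ?_, hu't⟩
    rw [hU, ← hc]
    exact (Submodule.span_singleton_smul_eq hcu u₀).symm
  · -- `c` a nonunit of the LOCAL ring `𝒪`: the glue module vanishes.  (1) `x₀ = a₀ t`, `a₀ ∈ O(L)`; `a₀` acts on `x₀` mod `J` as a scalar `χ`.
    obtain ⟨a₀, ha₀L, hx₀⟩ := hLt x₀ ((memL x₀).2 ⟨u₀, hu₀x₀⟩)
    have ha₀x₀L : a₀ * x₀ ∈ L :=
      (pointwise_smul_le_iff_forall a₀ L L).1 ha₀L x₀ ((memL x₀).2 ⟨u₀, hu₀x₀⟩)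
    obtain ⟨y₁, hy₁⟩ := (memL (a₀ * x₀)).1 ha₀x₀L
    have hy₁U : y₁ ∈ Λ.map ((LinearMap.fst E E K).restrictScalars 𝒪[E]) := (memU y₁).2 ⟨_, hy₁⟩
    rw [hU] at hy₁U
    obtain ⟨χ, hχ⟩ := Submodule.mem_span_singleton.1 hy₁U
    have hJa : a₀ * x₀ - χ • x₀ ∈ J := by
      rw [memJ]
      have h1 : ((y₁, a₀ * x₀) : E × K) - χ • (u₀, x₀) ∈ Λ := Λ.sub_mem hy₁ (Λ.smul_mem χ hu₀x₀)
      have h2 : ((y₁, a₀ * x₀) : E × K) - χ • (u₀, x₀) = (0, a₀ * x₀ - χ • x₀) := by rw [← hχ]; ext <;> simp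
      rwa [h2] at h1
    -- (2) `t - c • x₀ ∈ J` (the two lifts `(u', t)` and `c • (u₀, x₀)` have the same `U`-coordinate)
    have hJ1 : t - c • x₀ ∈ J := by
      rw [memJ]
      have h1 : ((u', t) : E × K) - c • (u₀, x₀) ∈ Λ := Λ.sub_mem hu't (Λ.smul_mem c hu₀x₀)
      have h2 : ((u', t) : E × K) - c • (u₀, x₀) = (0, t - c • x₀) := by rw [← hc]; ext <;> simp
      rwa [h2] at h1
    -- (3) `x₀ - (c χ) • x₀ ∈ J`:  `a₀ • (t - c x₀) ∈ J` (O(L)-stability), `= x₀ - c • (a₀ x₀)`, plus `c • (a₀ x₀ - χ x₀) ∈ J`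
    have hJ2 : x₀ - (c * χ) • x₀ ∈ J := by
      have h3 : a₀ * (t - c • x₀) ∈ J := (pointwise_smul_le_iff_forall a₀ J J).1 (hJ a₀ ha₀L) _ hJ1
      have h4 : c • (a₀ * x₀ - χ • x₀) ∈ J := J.smul_mem c hJa
      have h5 := J.add_mem h3 h4
      have h6 : a₀ * (t - c • x₀) + c • (a₀ * x₀ - χ • x₀) = x₀ - (c * χ) • x₀ := by
        simp only [hx₀, Algebra.smul_def, map_mul]
        ring
      rwa [h6] at h5
    -- (4) `1 - c χ` is a unit (as `c χ` is not), so `x₀ ∈ J`, then `t ∈ J`, `(u₀, 0) ∈ Λ`, `(u₀, t) ∈ Λ`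
    have hunit : IsUnit (1 - c * χ) := by
      rcases IsLocalRing.isUnit_or_isUnit_one_sub_self (c * χ) with h | h
      · exact absurd (isUnit_of_mul_isUnit_left h) hcu
      · exact h
    obtain ⟨w, hw⟩ := hunit
    have hx₀J : x₀ ∈ J := by
      have h := J.smul_mem (↑w⁻¹ : 𝒪[E]) hJ2
      have h' : (↑w⁻¹ : 𝒪[E]) • (x₀ - (c * χ) • x₀) = x₀ := by
        rw [show x₀ - (c * χ) • x₀ = (1 - c * χ) • x₀ by rw [sub_smul, one_smul], ← mul_smul, ← hw, Units.inv_mul, one_smul]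
      rwa [h'] at h
    have htJ : t ∈ J := by
      have h := J.add_mem hJ1 (J.smul_mem c hx₀J)
      rwa [sub_add_cancel] at h
    refine ⟨u₀, hU, ?_⟩
    have h1 : ((u₀, x₀) : E × K) - (0, x₀) + (0, t) ∈ Λ := Λ.add_mem (Λ.sub_mem hu₀x₀ ((memJ x₀).1 hx₀J)) ((memJ t).1 htJ)
    simpa using h1

/-- **The multiplier ring of a glued lattice contains the glued order** (the direction used for cyclicity): if `prU Λ = 𝒪u₁`, `(u₁, t) ∈ Λ` and `J` is `O(L)`-stable, then for
`y ∈ 𝒪`, `a ∈ O(L)` with `(a − y)·t ∈ J` the element `(y, a) ∈ E × K` stabilises `Λ`. [cite: Jacobowitz1962, §4] [cite: Serre1980Trees, II.1.1] -/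
theorem smul_le_of_glued (Λ : Submodule 𝒪[E] (E × K)) (u₁ : E) (t : K)
    (hU : Λ.map ((LinearMap.fst E E K).restrictScalars 𝒪[E]) = 𝒪[E] ∙ u₁) (hv : ((u₁, t) : E × K) ∈ Λ)
    (hJ : ∀ a : K, a • Λ.map ((LinearMap.snd E E K).restrictScalars 𝒪[E]) ≤ Λ.map ((LinearMap.snd E E K).restrictScalars 𝒪[E]) →
      a • Λ.comap ((LinearMap.inr E E K).restrictScalars 𝒪[E]) ≤ Λ.comap ((LinearMap.inr E E K).restrictScalars 𝒪[E]))
    (y : 𝒪[E]) (a : K) (haL : a • Λ.map ((LinearMap.snd E E K).restrictScalars 𝒪[E]) ≤ Λ.map ((LinearMap.snd E E K).restrictScalars 𝒪[E]))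
    (hat : ((0, (a - algebraMap E K y) * t) : E × K) ∈ Λ) :
    (((y : E), a) : E × K) • Λ ≤ Λ := by
  set L := Λ.map ((LinearMap.snd E E K).restrictScalars 𝒪[E]) with hLdef
  set J := Λ.comap ((LinearMap.inr E E K).restrictScalars 𝒪[E]) with hJdef
  have memU : ∀ y : E, y ∈ Λ.map ((LinearMap.fst E E K).restrictScalars 𝒪[E]) ↔ ∃ x : K, ((y, x) : E × K) ∈ Λ := by
    intro y
    simp only [Submodule.mem_map, LinearMap.coe_restrictScalars, LinearMap.fst_apply, Prod.exists, exists_and_right,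
      exists_eq_right]
  have memJ : ∀ x : K, x ∈ J ↔ ((0, x) : E × K) ∈ Λ := by
    intro x
    simp only [hJdef, Submodule.mem_comap, LinearMap.coe_restrictScalars, LinearMap.inr_apply]
  refine (pointwise_smul_le_iff_forall _ Λ Λ).2 ?_
  rintro ⟨y', x'⟩ hm
  -- `y' = s' • u₁`, `x' = s' • t + j` with `j ∈ J`
  have hy'U : y' ∈ Λ.map ((LinearMap.fst E E K).restrictScalars 𝒪[E]) := (memU y').2 ⟨x', hm⟩
  rw [hU] at hy'U
  obtain ⟨s', hs'⟩ := Submodule.mem_span_singleton.1 hy'U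
  have hjJ : x' - s' • t ∈ J := by
    rw [memJ]
    have h1 : ((y', x') : E × K) - s' • (u₁, t) ∈ Λ := Λ.sub_mem hm (Λ.smul_mem s' hv)
    have h2 : ((y', x') : E × K) - s' • (u₁, t) = (0, x' - s' • t) := by rw [← hs']; ext <;> simp
    rwa [h2] at h1
  have hajJ : a * (x' - s' • t) ∈ J := (pointwise_smul_le_iff_forall a J J).1 (hJ a haL) _ hjJ
  have hstJ : s' • ((a - algebraMap E K y) * t) ∈ J := J.smul_mem s' ((memJ _).2 hat)
  -- `(y y', a x') = (s' y) • (u₁, t) + (0, s' (a - y) t + a j)`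
  have hsum : (((y : E), a) : E × K) • ((y', x') : E × K) =
      (s' * y) • ((u₁, t) : E × K) + (0, s' • ((a - algebraMap E K y) * t) + a * (x' - s' • t)) := by
    rw [← hs']
    ext
    · simp [Algebra.smul_def, algebraMap_valuationInteger_self, mul_comm, mul_left_comm]
    · simp only [smul_eq_mul, Prod.snd_mul, Prod.snd_add, Prod.smul_snd]
      simp only [Algebra.smul_def, algebraMap_valuationInteger_eq (K := K), Subring.coe_mul, map_mul]
      ring
  rw [hsum]
  exact Λ.add_mem (Λ.smul_mem _ hv) ((memJ _).1 (J.add_mem hstJ hajJ))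

/-- **The multiplier ring of a glued lattice IS the glued order**: with `prU Λ = 𝒪u₁` (`u₁ ≠ 0`), `(u₁, t) ∈ Λ` and `J` `O(L)`-stable,
`(y, a) • Λ ≤ Λ ⟺ y ∈ 𝒪 ∧ a • L ≤ L ∧ (a − y)·t ∈ J` («`χ(a) ≡ y` on the cyclic glue module»). [cite: Jacobowitz1962, §4] [cite: Serre1980Trees, II.1.1] -/
theorem smul_le_iff_of_glued (Λ : Submodule 𝒪[E] (E × K)) (u₁ : E) (t : K)
    (hU : Λ.map ((LinearMap.fst E E K).restrictScalars 𝒪[E]) = 𝒪[E] ∙ u₁) (hu₁ : u₁ ≠ 0) (hv : ((u₁, t) : E × K) ∈ Λ)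
    (hJ : ∀ a : K, a • Λ.map ((LinearMap.snd E E K).restrictScalars 𝒪[E]) ≤ Λ.map ((LinearMap.snd E E K).restrictScalars 𝒪[E]) →
      a • Λ.comap ((LinearMap.inr E E K).restrictScalars 𝒪[E]) ≤ Λ.comap ((LinearMap.inr E E K).restrictScalars 𝒪[E]))
    (y : E) (a : K) :
    ((y, a) : E × K) • Λ ≤ Λ ↔ y ∈ 𝒪[E] ∧ a • Λ.map ((LinearMap.snd E E K).restrictScalars 𝒪[E]) ≤ Λ.map ((LinearMap.snd E E K).restrictScalars 𝒪[E]) ∧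
      ((0, (a - algebraMap E K y) * t) : E × K) ∈ Λ := by
  set L := Λ.map ((LinearMap.snd E E K).restrictScalars 𝒪[E]) with hLdef
  have memU : ∀ y : E, y ∈ Λ.map ((LinearMap.fst E E K).restrictScalars 𝒪[E]) ↔ ∃ x : K, ((y, x) : E × K) ∈ Λ := by
    intro y
    simp only [Submodule.mem_map, LinearMap.coe_restrictScalars, LinearMap.fst_apply, Prod.exists, exists_and_right,
      exists_eq_right]
  have memL : ∀ x : K, x ∈ L ↔ ∃ y : E, ((y, x) : E × K) ∈ Λ := by
    intro x
    simp only [hLdef, Submodule.mem_map, LinearMap.coe_restrictScalars, LinearMap.snd_apply, Prod.exists, exists_eq_right]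
  constructor
  · intro h
    have hmem : ∀ m ∈ Λ, ((y, a) : E × K) * m ∈ Λ := fun m hm => h (Submodule.smul_mem_pointwise_smul m ((y, a) : E × K) Λ hm)
    have hyt : ((y * u₁, a * t) : E × K) ∈ Λ := by simpa using hmem _ hv
    -- `y ∈ 𝒪`: `y u₁ ∈ prU = 𝒪 u₁` and `u₁ ≠ 0`
    have hyU : y * u₁ ∈ Λ.map ((LinearMap.fst E E K).restrictScalars 𝒪[E]) := (memU _).2 ⟨_, hyt⟩
    rw [hU] at hyU
    obtain ⟨s, hs⟩ := Submodule.mem_span_singleton.1 hyU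
    have hys : y = (s : E) := by
      have : (s : E) * u₁ = y * u₁ := by simpa [Subring.smul_def] using hs
      exact (mul_right_cancel₀ hu₁ this).symm
    refine ⟨hys ▸ s.2, (pointwise_smul_le_iff_forall a L L).2 fun x hx => ?_, ?_⟩
    · obtain ⟨y', hy'⟩ := (memL x).1 hx
      exact (memL _).2 ⟨y * y', by simpa using hmem _ hy'⟩
    · have h1 : ((y * u₁, a * t) : E × K) - s • (u₁, t) ∈ Λ := Λ.sub_mem hyt (Λ.smul_mem s hv)
      have h2 : ((y * u₁, a * t) : E × K) - s • (u₁, t) = (0, (a - algebraMap E K y) * t) := by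
        rw [hys]; ext <;> simp [Algebra.smul_def, algebraMap_valuationInteger_self, algebraMap_valuationInteger_eq (K := K), sub_mul]
      rwa [h2] at h1
  · rintro ⟨hy, haL, hat⟩
    exact smul_le_of_glued Λ u₁ t hU hv hJ ⟨y, hy⟩ a haL hat

/-- **(O4-G), STRUCTURE LEMMA: a glued lattice is CYCLIC over its multiplier ring.**  If `prU Λ` is cyclic, `L = pr_W Λ = O(L)·t` is principal over its multiplier order and
`J = Λ ∩ W` is `O(L)`-stable, then `Λ = O(Λ)·v` for some `v ∈ Λ` (namely `v = (u₁, t)`: for `(y, x) = (s u₁, a t) ∈ Λ` the multiplier is `(s, a)`).  Hence `Λ` is an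
invertible `O(Λ)`-module; no Nakayama, Goursat or Gorenstein theory is used. [cite: Jacobowitz1962, §4, §7] [cite: Serre1980Trees, II.1.1] [cite: Bass1963, §7] -/
theorem exists_generator_of_glued (Λ : Submodule 𝒪[E] (E × K))
    (hU : ∃ u₀ : E, Λ.map ((LinearMap.fst E E K).restrictScalars 𝒪[E]) = 𝒪[E] ∙ u₀)
    (t : K) (ht : t ∈ Λ.map ((LinearMap.snd E E K).restrictScalars 𝒪[E]))
    (hLt : ∀ x ∈ Λ.map ((LinearMap.snd E E K).restrictScalars 𝒪[E]),
      ∃ a : K, a • Λ.map ((LinearMap.snd E E K).restrictScalars 𝒪[E]) ≤ Λ.map ((LinearMap.snd E E K).restrictScalars 𝒪[E]) ∧ x = a * t)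
    (hJ : ∀ a : K, a • Λ.map ((LinearMap.snd E E K).restrictScalars 𝒪[E]) ≤ Λ.map ((LinearMap.snd E E K).restrictScalars 𝒪[E]) →
      a • Λ.comap ((LinearMap.inr E E K).restrictScalars 𝒪[E]) ≤ Λ.comap ((LinearMap.inr E E K).restrictScalars 𝒪[E])) :
    ∃ v ∈ Λ, ∀ x ∈ Λ, ∃ b : E × K, b • Λ ≤ Λ ∧ x = b * v := by
  obtain ⟨u₀, hu₀⟩ := hU
  obtain ⟨u₁, hU₁, hv⟩ := exists_fst_generator_mem Λ u₀ hu₀ t ht hLt hJ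
  have memU : ∀ y : E, y ∈ Λ.map ((LinearMap.fst E E K).restrictScalars 𝒪[E]) ↔ ∃ x : K, ((y, x) : E × K) ∈ Λ := by
    intro y
    simp only [Submodule.mem_map, LinearMap.coe_restrictScalars, LinearMap.fst_apply, Prod.exists, exists_and_right,
      exists_eq_right]
  have memL : ∀ x : K, x ∈ Λ.map ((LinearMap.snd E E K).restrictScalars 𝒪[E]) ↔ ∃ y : E, ((y, x) : E × K) ∈ Λ := by
    intro x
    simp only [Submodule.mem_map, LinearMap.coe_restrictScalars, LinearMap.snd_apply, Prod.exists, exists_eq_right]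
  refine ⟨(u₁, t), hv, ?_⟩
  rintro ⟨y, x⟩ hm
  -- `x = a t` with `a ∈ O(L)`, `y = s u₁` with `s ∈ 𝒪`; the multiplier is `(s, a)`
  obtain ⟨a, haL, hxa⟩ := hLt x ((memL x).2 ⟨y, hm⟩)
  have hyU : y ∈ Λ.map ((LinearMap.fst E E K).restrictScalars 𝒪[E]) := (memU y).2 ⟨x, hm⟩
  rw [hU₁] at hyU
  obtain ⟨s, hs⟩ := Submodule.mem_span_singleton.1 hyU
  have hat : ((0, (a - algebraMap E K (s : E)) * t) : E × K) ∈ Λ := by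
    have h1 : ((y, x) : E × K) - s • (u₁, t) ∈ Λ := Λ.sub_mem hm (Λ.smul_mem s hv)
    have h2 : ((y, x) : E × K) - s • (u₁, t) = (0, (a - algebraMap E K (s : E)) * t) := by
      rw [← hs, hxa]; ext <;> simp [Algebra.smul_def, algebraMap_valuationInteger_self, algebraMap_valuationInteger_eq (K := K), sub_mul]
    rwa [h2] at h1
  refine ⟨((s : E), a), smul_le_of_glued Λ u₁ t hU₁ hv hJ s a haL hat, ?_⟩
  rw [← hs, hxa]; ext <;> simp [Algebra.smul_def, algebraMap_valuationInteger_self]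

/-! ## §3 Self-duality for an orthogonal pairing supplies the gluing hypothesis -/

/-- For a pairing `P` on `E × K` that is ORTHOGONAL with `W`-component `T` (`P m (0, x′) = T m.2 x′`), a self-dual `Λ = Λ^#` has `Λ ∩ W = (pr_W Λ)^#`:
`x′ ∈ J ⟺ ∀ x ∈ L, T x x′ ∈ 𝒪`. [cite: Jacobowitz1962, §4] -/
theorem mem_comap_inr_iff_of_selfDual (Λ : Submodule 𝒪[E] (E × K)) (P : E × K → E × K → E) (T : K → K → E)
    (hPT : ∀ (m : E × K) (x' : K), P m (0, x') = T m.2 x')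
    (hsd : ∀ m : E × K, m ∈ Λ ↔ ∀ m' ∈ Λ, P m' m ∈ 𝒪[E]) (x' : K) :
    x' ∈ Λ.comap ((LinearMap.inr E E K).restrictScalars 𝒪[E]) ↔
      ∀ x ∈ Λ.map ((LinearMap.snd E E K).restrictScalars 𝒪[E]), T x x' ∈ 𝒪[E] := by
  have memL : ∀ x : K, x ∈ Λ.map ((LinearMap.snd E E K).restrictScalars 𝒪[E]) ↔ ∃ y : E, ((y, x) : E × K) ∈ Λ := by
    intro x
    simp only [Submodule.mem_map, LinearMap.coe_restrictScalars, LinearMap.snd_apply, Prod.exists, exists_eq_right]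
  simp only [Submodule.mem_comap, LinearMap.coe_restrictScalars, LinearMap.inr_apply]
  rw [hsd]
  constructor
  · intro h x hx
    obtain ⟨y, hy⟩ := (memL x).1 hx
    simpa [hPT] using h _ hy
  · rintro h ⟨y, x⟩ hm
    rw [hPT]
    exact h x ((memL x).2 ⟨y, hm⟩)

/-- **(D) Self-duality ⇒ the `O(L)`-stability of `J`.**  For an orthogonal pairing `P` (component `T` on `W`) admitting an ADJOINT map `†` on `K` (`T x (a x′) = T (a† x) x′`)
such that the multiplier order `O(L)` of `L = pr_W Λ` is `†`-stable, every self-dual `Λ = Λ^#` satisfies hypothesis `hJ` of the structure lemma: `a ∈ O(L) ⇒ a • J ≤ J`.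
(In the CM application `†` is the adjoint involution of the `K₂`-line and `O(L) = 𝒪_E + ϖ^{N′}𝒪_{K₂}` is `†`-stable.) [cite: Jacobowitz1962, §4] -/
theorem smul_comap_inr_le_of_selfDual (Λ : Submodule 𝒪[E] (E × K)) (P : E × K → E × K → E) (T : K → K → E) (dag : K → K)
    (hPT : ∀ (m : E × K) (x' : K), P m (0, x') = T m.2 x')
    (hT : ∀ (a x x' : K), T x (a * x') = T (dag a * x) x')
    (hsd : ∀ m : E × K, m ∈ Λ ↔ ∀ m' ∈ Λ, P m' m ∈ 𝒪[E])
    (hdag : ∀ a : K, a • Λ.map ((LinearMap.snd E E K).restrictScalars 𝒪[E]) ≤ Λ.map ((LinearMap.snd E E K).restrictScalars 𝒪[E]) →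
      dag a • Λ.map ((LinearMap.snd E E K).restrictScalars 𝒪[E]) ≤ Λ.map ((LinearMap.snd E E K).restrictScalars 𝒪[E]))
    (a : K) (ha : a • Λ.map ((LinearMap.snd E E K).restrictScalars 𝒪[E]) ≤ Λ.map ((LinearMap.snd E E K).restrictScalars 𝒪[E])) :
    a • Λ.comap ((LinearMap.inr E E K).restrictScalars 𝒪[E]) ≤ Λ.comap ((LinearMap.inr E E K).restrictScalars 𝒪[E]) := by
  refine (pointwise_smul_le_iff_forall a _ _).2 fun x' hx' => ?_
  rw [mem_comap_inr_iff_of_selfDual Λ P T hPT hsd] at hx' ⊢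
  intro x hx
  rw [smul_eq_mul, hT]
  exact hx' _ ((pointwise_smul_le_iff_forall (dag a) _ _).1 (hdag a ha) x hx)

end Literature.NumberTheory.Automorphic
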